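import Mathlib
import HarnessLib
import Literature.Analysis.FluidPDE.ClassicalSolution
import Literature.Analysis.FluidPDE.LerayHopf
import Literature.Analysis.FluidPDE.WholeSpaceIBPIntegrable
import Literature.Analysis.FluidPDE.ConstantinFeffermanStretching
import Summits.NavierStokesRegularity.NavierStokesRegularity.Theorems.QuarterJoltTerminalPairingStatic

/-!
# Route QuarterJolt — crux `NoTerminalJolt` (stmt-NavierStokesRegularity-26463), LEAD line
# `regular_split` rev 5: SLICE TESTING, I — the transport term integrated by parts ONTO the test
# field

Seat ns-ntj-p1 g4 (LEAD of the crux; `--supports 26463 --as helper`). First file of the TYPE-I ENERGY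
EQUALITY chain (`QuarterJoltSliceTestTransport` → `QuarterJoltSliceTestStatic` →
`QuarterJoltSliceTestIncrement` → `QuarterJoltTypeIEnergyEquality`): at a first blow-up time `T` with the Type-I rate
`‖u(τ)‖_∞ ≤ C/√(T−τ)` the energy has NO JUMP, `‖u(t) − u(T)‖_{L²} → 0` (Leslie–Shvydkoy, ARMA 230
(2018) Thm. 1.2; Cheskidov–Luo, Nonlinearity 33 (2020) Cor. 1.2) — here by an ELEMENTARY argument
special to the first-blow-up frame: test the momentum equation on `(t,T)` against the frozen REGULAR
slice `U = u(t)` itself. The one new ingredient over the g3 pairing files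
(`QuarterJoltTerminalPairingStatic`, p634428) is that the transport term is integrated by parts onto
the test field,
`∫⟪U, (v·∇)v⟫ = −∫⟪(v·∇)U, v⟫`, `|∫⟪U, (v·∇)v⟫| ≤ ‖v‖_∞ ‖v‖₂ ‖DU‖₂`,
so that the SUP NORM OF THE MOVING SLICE `v = u(τ)` (Type I: `C/√(T−τ)`, integrable up to `T`) and
only the `L²` size of `DU = Du(t)` enter — instead of `‖U‖_∞ ‖v‖₂ ‖Dv‖₂` (g3), which is not integrable
up to `T`.

THIS FILE (static fields; a priori calculus, route-independent in content):

* `inner_gradient_inner_eq` — `⟪v, ∇⟪U, v⟫⟫ = ⟪(v·∇)U, v⟫ + ⟪U, (v·∇)v⟫` (product rule).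
* `integral_inner_convect_self_eq_neg` — for `v ∈ C¹` bounded, divergence free, `v, Dv ∈ L²` and
  `U ∈ C¹`, `U, DU ∈ L²`: `∫⟪U, (v·∇)v⟫ = −∫⟪(v·∇)U, v⟫` (whole-space integration by parts,
  `integral_mul_divergence_add_eq_zero_of_integrable` with `θ = ⟪U, v⟫`).
* `abs_integral_inner_convect_self_le` — `|∫⟪U, (v·∇)v⟫| ≤ M √(∫‖v‖²) √(∫|DU|²_F)`, `‖v‖ ≤ M`.

HONEST FRAMING: a priori calculus for classical solutions; nothing here concerns the truth of
`NoTerminalJolt` or Navier–Stokes regularity. No summit statement is proved here. [folklore]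
-/

noncomputable section

-- the summit and its single sub-problem share the name (CONVENTIONS §1), as in every Theorems file
set_option linter.dupNamespace false

namespace Summit.NavierStokesRegularity.NavierStokesRegularity.Theorems

open MeasureTheory Set Function Filter Topology InnerProductSpace
open scoped ENNReal NNReal ContDiff RealInnerProductSpace Laplacian
open Literature.Analysis.FluidPDE

namespace NoTerminalJolt

/-! ### The transport term integrated by parts onto the test field -/

/-- **Product rule**: for `U, v ∈ C¹`, `⟪v(x), ∇⟪U, v⟫(x)⟫ = ⟪(v·∇)U (x), v x⟫ + ⟪U x, (v·∇)v (x)⟫`.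
[folklore] -/
theorem inner_gradient_inner_eq {U v : EuclideanSpace ℝ (Fin 3) → EuclideanSpace ℝ (Fin 3)}
    (hU : ContDiff ℝ 1 U) (hv : ContDiff ℝ 1 v) (x : EuclideanSpace ℝ (Fin 3)) :
    ⟪v x, gradient (fun y => ⟪U y, v y⟫) x⟫ = ⟪convect v U x, v x⟫ + ⟪U x, convect v v x⟫ := by
  rw [gradient, real_inner_comm, InnerProductSpace.toDual_symm_apply,
    fderiv_inner_apply ℝ (hU.differentiable one_ne_zero x) (hv.differentiable one_ne_zero x)]
  simp [convect, add_comm]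

/-- **The transport pairing, integrated by parts onto the test field.** For `v ∈ C¹(ℝ³;ℝ³)` bounded
(`‖v‖ ≤ M`), divergence free, with `v, Dv ∈ L²`, and `U ∈ C¹` with `U, DU ∈ L²`:
`∫⟪U, (v·∇)v⟫ = −∫⟪(v·∇)U, v⟫` (`div (⟪U,v⟫ v) = ⟪v, ∇⟪U,v⟫⟫ = ⟪(v·∇)U, v⟫ + ⟪U, (v·∇)v⟫`
integrates to zero). [folklore] -/
theorem integral_inner_convect_self_eq_neg {U v : EuclideanSpace ℝ (Fin 3) → EuclideanSpace ℝ (Fin 3)}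
    (hU : ContDiff ℝ 1 U) (hv : ContDiff ℝ 1 v) (hdivv : VectorCalculus.IsDivFree v)
    {M : ℝ} (hM : ∀ x, ‖v x‖ ≤ M)
    (l2v : ∫⁻ x, ‖v x‖ₑ ^ 2 < ⊤) (l2Dv : ∫⁻ x, ‖fderiv ℝ v x‖ₑ ^ 2 < ⊤)
    (l2U : ∫⁻ x, ‖U x‖ₑ ^ 2 < ⊤) (l2DU : ∫⁻ x, ‖fderiv ℝ U x‖ₑ ^ 2 < ⊤) :
    ∫ x, ⟪U x, convect v v x⟫ = -∫ x, ⟪convect v U x, v x⟫ := by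
  have cv : Continuous v := hv.continuous
  have cU : Continuous U := hU.continuous
  have cDv : Continuous (fderiv ℝ v) := hv.continuous_fderiv one_ne_zero
  have cDU : Continuous (fderiv ℝ U) := hU.continuous_fderiv one_ne_zero
  have hM0 : 0 ≤ M := (norm_nonneg _).trans (hM 0)
  have cMv : Continuous fun x => M • v x := cv.const_smul M
  have cMU : Continuous fun x => M • U x := cU.const_smul M
  have l2Mv : ∫⁻ x, ‖M • v x‖ₑ ^ 2 < ⊤ := lintegral_enorm_sq_const_smul_lt_top M l2v
  have l2MU : ∫⁻ x, ‖M • U x‖ₑ ^ 2 < ⊤ := lintegral_enorm_sq_const_smul_lt_top M l2U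
  have nMv : ∀ x, ‖M • v x‖ = M * ‖v x‖ := fun x => by
    rw [norm_smul, Real.norm_of_nonneg hM0]
  have nMU : ∀ x, ‖M • U x‖ = M * ‖U x‖ := fun x => by
    rw [norm_smul, Real.norm_of_nonneg hM0]
  obtain ⟨θ, hθ⟩ : ∃ θ : EuclideanSpace ℝ (Fin 3) → ℝ, θ = fun x => ⟪U x, v x⟫ := ⟨_, rfl⟩
  have hθx : ∀ x, θ x = ⟪U x, v x⟫ := fun x => by rw [hθ]
  have hθ1 : ContDiff ℝ 1 θ := by rw [hθ]; exact hU.inner ℝ hv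
  -- integrability of `θ v`
  have hint : Integrable (fun x => θ x • v x) volume := by
    refine integrable_of_norm_le_mul_of_lintegral_sq ((hθ1.continuous.smul cv).aestronglyMeasurable)
      cU cMv l2U l2Mv fun x => ?_
    rw [norm_smul, nMv, hθx]
    calc ‖⟪U x, v x⟫‖ * ‖v x‖ ≤ (‖U x‖ * ‖v x‖) * ‖v x‖ :=
          mul_le_mul_of_nonneg_right (norm_inner_le_norm _ _) (norm_nonneg _)
      _ ≤ (‖U x‖ * ‖v x‖) * M := mul_le_mul_of_nonneg_left (hM x) (by positivity)
      _ = ‖U x‖ * (M * ‖v x‖) := by ring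
  -- the divergence term vanishes identically
  have h₁ : Integrable (fun x => θ x * VectorCalculus.divergence v x) volume := by
    have : (fun x => θ x * VectorCalculus.divergence v x) = fun _ => 0 := by
      funext x; rw [hdivv x, mul_zero]
    rw [this]; exact integrable_zero _ _ _
  -- the two pieces of `⟪v, ∇θ⟫`
  have i1 : Integrable (fun x => ⟪convect v U x, v x⟫) volume := by
    refine integrable_of_norm_le_mul_of_lintegral_sq ((cDU.clm_apply cv).inner cv).aestronglyMeasurable
      cDU cMv l2DU l2Mv fun x => ?_
    rw [nMv]
    calc ‖⟪convect v U x, v x⟫‖ ≤ ‖convect v U x‖ * ‖v x‖ := norm_inner_le_norm _ _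
      _ ≤ (‖fderiv ℝ U x‖ * ‖v x‖) * ‖v x‖ :=
          mul_le_mul_of_nonneg_right ((fderiv ℝ U x).le_opNorm (v x)) (norm_nonneg _)
      _ ≤ (‖fderiv ℝ U x‖ * ‖v x‖) * M := mul_le_mul_of_nonneg_left (hM x) (by positivity)
      _ = ‖fderiv ℝ U x‖ * (M * ‖v x‖) := by ring
  have i2 : Integrable (fun x => ⟪U x, convect v v x⟫) volume := by
    refine integrable_of_norm_le_mul_of_lintegral_sq ((cU.inner (cDv.clm_apply cv))).aestronglyMeasurable
      cMU cDv l2MU l2Dv fun x => ?_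
    rw [nMU]
    calc ‖⟪U x, convect v v x⟫‖ ≤ ‖U x‖ * ‖convect v v x‖ := norm_inner_le_norm _ _
      _ ≤ ‖U x‖ * (‖fderiv ℝ v x‖ * ‖v x‖) :=
          mul_le_mul_of_nonneg_left ((fderiv ℝ v x).le_opNorm (v x)) (norm_nonneg _)
      _ ≤ ‖U x‖ * (‖fderiv ℝ v x‖ * M) := by gcongr; exact hM x
      _ = M * ‖U x‖ * ‖fderiv ℝ v x‖ := by ring
  have hpt : ∀ x, ⟪v x, gradient θ x⟫ = ⟪convect v U x, v x⟫ + ⟪U x, convect v v x⟫ := fun x => by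
    rw [hθ]; exact inner_gradient_inner_eq hU hv x
  have h₂ : Integrable (fun x => ⟪v x, gradient θ x⟫) volume := by
    have : (fun x => ⟪v x, gradient θ x⟫) = fun x => ⟪convect v U x, v x⟫ + ⟪U x, convect v v x⟫ :=
      funext hpt
    rw [this]; exact i1.add i2
  have h := integral_mul_divergence_add_eq_zero_of_integrable hθ1 hv hint h₁ h₂
  have hz : ∫ x, θ x * VectorCalculus.divergence v x = 0 := by
    have : (fun x => θ x * VectorCalculus.divergence v x) = fun _ => 0 := by
      funext x; rw [hdivv x, mul_zero]
    rw [this, integral_zero]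
  rw [hz, zero_add, integral_congr_ae (Eventually.of_forall hpt), integral_add i1 i2] at h
  linarith

/-- **The transport pairing is controlled by the sup norm of the moving field and the gradient of the
test field**: under the hypotheses of `integral_inner_convect_self_eq_neg`,
`|∫⟪U, (v·∇)v⟫| ≤ M · √(∫‖v‖²) · √(∫|DU|²_F)`. [folklore] -/
theorem abs_integral_inner_convect_self_le {U v : EuclideanSpace ℝ (Fin 3) → EuclideanSpace ℝ (Fin 3)}
    (hU : ContDiff ℝ 1 U) (hv : ContDiff ℝ 1 v) (hdivv : VectorCalculus.IsDivFree v)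
    {M : ℝ} (hM : ∀ x, ‖v x‖ ≤ M)
    (l2v : ∫⁻ x, ‖v x‖ₑ ^ 2 < ⊤) (l2Dv : ∫⁻ x, ‖fderiv ℝ v x‖ₑ ^ 2 < ⊤)
    (l2U : ∫⁻ x, ‖U x‖ₑ ^ 2 < ⊤) (l2DU : ∫⁻ x, ‖fderiv ℝ U x‖ₑ ^ 2 < ⊤) :
    |∫ x, ⟪U x, convect v v x⟫| ≤
      M * (Real.sqrt (∫ x, ‖v x‖ ^ 2) * Real.sqrt (∫ x, frobeniusNormSq (fderiv ℝ U x))) := by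
  have cv : Continuous v := hv.continuous
  have cU : Continuous U := hU.continuous
  have cDU : Continuous (fderiv ℝ U) := hU.continuous_fderiv one_ne_zero
  have hM0 : 0 ≤ M := (norm_nonneg _).trans (hM 0)
  have cMv : Continuous fun x => M • v x := cv.const_smul M
  have l2Mv : ∫⁻ x, ‖M • v x‖ₑ ^ 2 < ⊤ := lintegral_enorm_sq_const_smul_lt_top M l2v
  have nMv : ∀ x, ‖M • v x‖ = M * ‖v x‖ := fun x => by
    rw [norm_smul, Real.norm_of_nonneg hM0]
  rw [integral_inner_convect_self_eq_neg hU hv hdivv hM l2v l2Dv l2U l2DU, abs_neg]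
  -- `|∫⟪(v·∇)U, v⟫| ≤ ∫ ‖DU‖ ‖M v‖ ≤ √(∫‖DU‖²) √(∫‖Mv‖²)`
  have hpt : ∀ x, ‖⟪convect v U x, v x⟫‖ ≤ ‖fderiv ℝ U x‖ * ‖M • v x‖ := fun x => by
    rw [nMv]
    calc ‖⟪convect v U x, v x⟫‖ ≤ ‖convect v U x‖ * ‖v x‖ := norm_inner_le_norm _ _
      _ ≤ (‖fderiv ℝ U x‖ * ‖v x‖) * ‖v x‖ :=
          mul_le_mul_of_nonneg_right ((fderiv ℝ U x).le_opNorm (v x)) (norm_nonneg _)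
      _ ≤ (‖fderiv ℝ U x‖ * ‖v x‖) * M := mul_le_mul_of_nonneg_left (hM x) (by positivity)
      _ = ‖fderiv ℝ U x‖ * (M * ‖v x‖) := by ring
  have iDU2 : Integrable (fun x => ‖fderiv ℝ U x‖ ^ 2) volume :=
    integrable_sq_norm_of_lintegral_lt_top cDU l2DU
  have iMv2 : Integrable (fun x => ‖M • v x‖ ^ 2) volume :=
    integrable_sq_norm_of_lintegral_lt_top cMv l2Mv
  have iR : Integrable (fun x => (‖fderiv ℝ U x‖ ^ 2 + ‖M • v x‖ ^ 2) / 2) volume :=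
    (iDU2.add iMv2).div_const 2
  have iprod : Integrable (fun x => ‖fderiv ℝ U x‖ * ‖M • v x‖) volume := by
    refine Integrable.mono' iR (cDU.norm.mul cMv.norm).aestronglyMeasurable
      (Eventually.of_forall fun x => ?_)
    rw [Real.norm_of_nonneg (by positivity)]
    nlinarith [sq_nonneg (‖fderiv ℝ U x‖ - ‖M • v x‖), norm_nonneg (fderiv ℝ U x),
      norm_nonneg (M • v x)]
  have h1 : |∫ x, ⟪convect v U x, v x⟫| ≤ ∫ x, ‖fderiv ℝ U x‖ * ‖M • v x‖ := by
    rw [← Real.norm_eq_abs]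
    exact (norm_integral_le_integral_norm _).trans (integral_mono_of_nonneg
      (Eventually.of_forall fun x => norm_nonneg _) iprod (Eventually.of_forall hpt))
  have h2 := integral_norm_mul_norm_le_sqrt cDU cMv iDU2 iMv2
  -- `√(∫‖M v‖²) = M √(∫‖v‖²)` and `√(∫‖DU‖²) ≤ √(∫|DU|²_F)`
  have h3 : Real.sqrt (∫ x, ‖M • v x‖ ^ 2) = M * Real.sqrt (∫ x, ‖v x‖ ^ 2) := by
    have : (fun x => ‖M • v x‖ ^ 2) = fun x => M ^ 2 * ‖v x‖ ^ 2 := by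
      funext x; rw [nMv]; ring
    rw [this, integral_const_mul, Real.sqrt_mul' _ (integral_nonneg fun x => sq_nonneg _),
      Real.sqrt_sq hM0]
  have ifrobU : Integrable (fun x => frobeniusNormSq (fderiv ℝ U x)) volume := by
    have hlt : ∫⁻ x, ENNReal.ofReal (frobeniusNormSq (fderiv ℝ U x)) < ⊤ :=
      calc ∫⁻ x, ENNReal.ofReal (frobeniusNormSq (fderiv ℝ U x))
          ≤ ∫⁻ x, 3 * ‖fderiv ℝ U x‖ₑ ^ 2 :=
            lintegral_mono fun x => ofReal_frobeniusNormSq_le_three_mul_enorm_sq _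
        _ = 3 * ∫⁻ x, ‖fderiv ℝ U x‖ₑ ^ 2 := lintegral_const_mul' _ _ (by norm_num)
        _ < ⊤ := ENNReal.mul_lt_top (by norm_num) l2DU
    exact integrable_of_continuous_of_nonneg (continuous_frobeniusNormSq_fderiv hU (by simp))
      (fun x => frobeniusNormSq_nonneg _) hlt
  have h4 : Real.sqrt (∫ x, ‖fderiv ℝ U x‖ ^ 2) ≤ Real.sqrt (∫ x, frobeniusNormSq (fderiv ℝ U x)) :=
    Real.sqrt_le_sqrt (integral_mono iDU2 ifrobU fun x => sq_opNorm_le_frobeniusNormSq _)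
  have h5 : 0 ≤ M * Real.sqrt (∫ x, ‖v x‖ ^ 2) := by positivity
  calc |∫ x, ⟪convect v U x, v x⟫| ≤ ∫ x, ‖fderiv ℝ U x‖ * ‖M • v x‖ := h1
    _ ≤ Real.sqrt (∫ x, ‖fderiv ℝ U x‖ ^ 2) * Real.sqrt (∫ x, ‖M • v x‖ ^ 2) := h2
    _ = Real.sqrt (∫ x, ‖fderiv ℝ U x‖ ^ 2) * (M * Real.sqrt (∫ x, ‖v x‖ ^ 2)) := by rw [h3]
    _ ≤ Real.sqrt (∫ x, frobeniusNormSq (fderiv ℝ U x)) * (M * Real.sqrt (∫ x, ‖v x‖ ^ 2)) :=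
        mul_le_mul_of_nonneg_right h4 h5
    _ = M * (Real.sqrt (∫ x, ‖v x‖ ^ 2) * Real.sqrt (∫ x, frobeniusNormSq (fderiv ℝ U x))) := by
        ring

end NoTerminalJolt

end Summit.NavierStokesRegularity.NavierStokesRegularity.Theorems

end
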